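import Summits.QuantumFields.YangMills.Theorems.MirrorModularBoostsSoftKernelBoostCovarianceAsmUniformBoost
import Summits.QuantumFields.YangMills.Theorems.MirrorModularBoostsSoftKernelBoostCovarianceAsmTypedBoost

/-!
# Stub (T*) `stub_chainBoostVectors` — boost vectors from the chain, landed as `⟨(Ui), (Uii)⟩`

Line `Sketch` of crux `MirrorModularBoosts.SoftKernelBoostCovariance` (stmt-QuantumFields-14999): the registered model-blind
analysis stub (T*) in its v3.5 form (extra hypothesis `0 ≤ μ`; the composition runs it with `max μ 0`), proved by pairing the landed
assembly pieces `stub_asmUniformBoost` (p135459, conclusion (i): uniform planar boost vectors of type `n|μ|` in every degree) and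
`stub_asmTypedBoost` (p135579, conclusion (ii): type exactly `μ` at a level with planar invariance below).
-/

noncomputable section

namespace Summit.QuantumFields.YangMills.Theorems.SoftKernelBoostCovariance.Sketch

open scoped BigOperators SchwartzMap InnerProductSpace
open MeasureTheory Filter Topology
open Literature.MathematicalPhysics.QuantumLattice Literature.MathematicalPhysics.AQFT
  Literature.MathematicalPhysics.QuantumFieldTheory
open Summit.QuantumFields.YangMills.Theorems.NPointIsotropy.Negative (E4)
open Summit.QuantumFields.YangMills.Theorems.CurvatureBoostCovariance.Negative
  (OSPackage Translations Hypercubic EightFrameRP PlanarCone PlanarInvariant)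

/-- **Stub (T*) — BOOST VECTORS FROM THE CHAIN** (model-blind; registered v3.5 form with `0 ≤ μ`): for a one-species family with
E0', E3, translations, the eight frames and the planar cone, an `e₀`-reconstruction `h` with an operator cone family, and the sandwich
bound with exponent `μ ≥ 0` and constant `C`: (i) uniform planar boost vectors in every degree; (ii) type `μ` at a level `a ≥ 1` with
planar invariance on `⁰𝒮` in all degrees `≤ 2a − 2`.  Proof: `⟨stub_asmUniformBoost, stub_asmTypedBoost⟩`. -/
theorem stub_chainBoostVectors :
    open Literature.MathematicalPhysics.QuantumLattice Literature.MathematicalPhysics.AQFT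
      Literature.MathematicalPhysics.QuantumFieldTheory
      Summit.QuantumFields.YangMills.Theorems.CurvatureBoostCovariance.Negative
      Summit.QuantumFields.YangMills.Theorems.NPointIsotropy.Negative in
    ∀ (S₁ : SchwingerFamily E4) (h : OSReconstructionNoE1 S₁.toLabelled),
      S₁.toLabelled.HasLinearGrowth → S₁.toLabelled.IsSymmetric → Translations S₁ → EightFrameRP S₁ → PlanarCone S₁ →
      (∃ N : ℂ × ℂ → (h.Hilbert →L[ℂ] h.Hilbert),
          (∀ p : ℂ × ℂ, |p.2.im| < p.1.re → ‖N p‖ ≤ 1) ∧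
          (∀ ψ ψ' : h.Hilbert, DifferentiableOn ℂ (fun p : ℂ × ℂ => ⟪ψ, N p ψ'⟫_ℂ) {p : ℂ × ℂ | |p.2.im| < p.1.re}) ∧
          (∀ (t b : ℝ), 0 < t → ∀ ψ : h.Hilbert,
            N ((t : ℂ), (b : ℂ)) ψ = h.transfer t (h.translate (b • EuclideanSpace.single 1 1) ψ))) →
      ∀ (μ C : ℝ),
        (∀ (u v : ℝ), 0 < u → 0 < v → u ≤ 1 → v ≤ 1 →
           ∀ (f₁ : SchwartzMap (Fin 1 → E4) ℂ) (g hh : ℝ × ℝ → ℂ) (Mg Mh Mh' : ℝ),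
             (∀ x : Fin 1 → E4, f₁ x = g (x 0 0, x 0 1) * hh (x 0 2, x 0 3)) →
             (∀ p : ℝ × ℝ, g p ≠ 0 → u ≤ p.1 ∧ p.1 ≤ 2 * u) →
             MeasureTheory.Integrable g → (∫ p, ‖g p‖) ≤ Mg →
             MeasureTheory.Integrable hh → (∫ p, ‖hh p‖) ≤ Mh → (∀ p, ‖hh p‖ ≤ Mh') →
           ∀ (n : ℕ) (W : SchwartzMap (Fin n → E4) ℂ) (hW : IsTimeOrdered W)
             (hFW : IsTimeOrdered
               (SchwartzMap.appendTensor f₁ (translateMulti ((2 * u + v) • EuclideanSpace.single 0 1) W))),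
             ‖h.fieldVec (1 + n) (fun _ => ())
                 (SchwartzMap.appendTensor f₁ (translateMulti ((2 * u + v) • EuclideanSpace.single 0 1) W)) hFW‖
               ≤ C * Mg * (Mh + Mh') * (u ^ (-μ) + v ^ (-μ)) * ‖h.fieldVec n (fun _ => ()) W hW‖) →
        0 ≤ μ →
        (∀ (n : ℕ), ∃ N : ℝ, ∀ (F : SchwartzMap (Fin n → E4) ℂ), IsTimeOrdered F →
          HasCompactSupport (F : (Fin n → E4) → ℂ) →
          ∃ ε : ℝ, 0 < ε ∧ ∃ (V : ℂ → h.Hilbert) (C : ℝ),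
            DifferentiableOn ℂ V {θ : ℂ | |θ.re| < ε} ∧
            (∀ θ : ℂ, |θ.re| < ε → ‖V θ‖ ≤ C * Real.exp (N * |θ.im|)) ∧
            ∀ θ : ℝ, |θ| < ε → ∀ hθ : IsTimeOrdered (linActMulti (planeRot (0 : Fin 3) θ) F),
              V θ = h.fieldVec n (fun _ => ()) (linActMulti (planeRot (0 : Fin 3) θ) F) hθ) ∧
        (∀ a : ℕ, 1 ≤ a →
          (∀ N : ℕ, N + 2 ≤ 2 * a → ∀ R : E4 ≃ₗᵢ[ℝ] E4,
            LinearMap.det (R.toLinearEquiv : E4 →ₗ[ℝ] E4) = 1 →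
            R (EuclideanSpace.single 2 1) = EuclideanSpace.single 2 1 →
            R (EuclideanSpace.single 3 1) = EuclideanSpace.single 3 1 →
            ∀ F : SchwartzMap (Fin N → E4) ℂ, IsOffDiagonal F → S₁ N (linActMulti R F) = S₁ N F) →
          ∀ (F : SchwartzMap (Fin a → E4) ℂ), IsTimeOrdered F → HasCompactSupport (F : (Fin a → E4) → ℂ) →
            ∃ ε : ℝ, 0 < ε ∧ ∃ (V : ℂ → h.Hilbert) (C' : ℝ),
              DifferentiableOn ℂ V {θ : ℂ | |θ.re| < ε} ∧
              (∀ θ : ℂ, |θ.re| < ε → ‖V θ‖ ≤ C' * Real.exp (μ * |θ.im|)) ∧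
              ∀ θ : ℝ, |θ| < ε → ∀ hθ : IsTimeOrdered (linActMulti (planeRot (0 : Fin 3) θ) F),
                V θ = h.fieldVec a (fun _ => ()) (linActMulti (planeRot (0 : Fin 3) θ) F) hθ) :=
  fun S₁ h hlg hsym htr h8 hC hN μ C hS hμ =>
    ⟨stub_asmUniformBoost S₁ h hlg hsym htr h8 hC hN μ C hS, stub_asmTypedBoost S₁ h hlg hsym htr h8 hC hN μ C hS hμ⟩

end Summit.QuantumFields.YangMills.Theorems.SoftKernelBoostCovariance.Sketch

end
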